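/-
Copyright (c) 2026 the pub-hodgecm-mathlib formalisation cell (harness21).  Prover seat hodgecm-mathlib-K2E2-p07 (g0),
Track B «K2-LIT» ∕ h413, unit «CLASS-TRANSPORT» of the line `K2_E2_ThetaExhaustionByRigidity`, file #7: payment of the socket
`K2E2ThetaExhaustionByRigidity.ClassTransport.sig_K2E2TrHasFinComponentOfLocFEq` — LIU'S CARRIER `ω_H(μ, a, χ)[ιV]` AS A FINITE
COMPONENT OF A DISCRETE AUTOMORPHIC REPRESENTATION DEPENDS ON THE LINE `⟨a⟩` ONLY THROUGH ITS FINITE LOCAL NORM CLASSES.  2026-09-03.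
-/
import Summits.HodgeConjecture.HodgeConjecture.Theorems.H413LineClassTransportOfEquiv              -- ★ `rhoAtLine_lineClassTransport_of_equiv` ((C′) from the master equivalence)
import Literature.NumberTheory.Automorphic.Liu2021.Def411WeilCarriersAtLineClassTransportAllFrames -- ★ `Def411WeilCarriers.lineClassTransport_equiv` (the master, every rank ∕ frame)
import Literature.NumberTheory.Automorphic.UnitaryGroupCohomologicalForms                        -- ★ `DiscreteAutomorphicRep.HasFinComponent`, `finRep`
import Literature.RepresentationTheory.Liu2021.OscillatorConventions                               -- ★ `isOscillatorChar_toHeckeCharacter_iff` (Liu's `μ` is a splitting character)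
import HarnessLib

/-!
# K2_E2 road (h413 = stmt-HodgeConjecture-24833), unit «CLASS-TRANSPORT», file #7:
# `P.HasFinComponent ω_H(μ, a, χ)[ιV]` depends on `a` only through `locF a` (the finite local norm classes of the line)

Cell `pub/hodgecm-mathlib` (D-0151), Track B (21-frontier RULING «PUSH BOTH» 2026-09-03, director req621∕req624, chair K2-lead
ORDER #1 §4.4 ∕ ORDER #2, SKELETON LANDED K2E2 l. 72395), socket module
`Summits/HodgeConjecture/HodgeConjecture/Cruxes/H413/Lines/K2_E2_ThetaExhaustionByRigidity_ClassTransport.lean` (planner K2E2-plan (g0),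
sha16 c1718b627d06a747), socket **`sig_K2E2TrHasFinComponentOfLocFEq`** (TR-3, #7, size S): for a CM field `L`, ANY rank `N`, ANY
hermitian `H`, ANY frame `e₁ : Fin N × Fin 1 ≃ Fin n′`, a real non-zero diagonal `dV`, ANY homomorphism
`ιV : U(H)(𝔸_{L⁺,f}) →* U(diag dV)(𝔸_{L⁺,f})`, a discrete automorphic representation `P` of `U(H)`, a conjugate-symplectic class-group
character `μ`, lines `a, a′ ∈ (L⁺)ˣ` and `χ ∈ Chi`: if `locF a′ = locF a` and Liu's carrier `ω_H(μ, a, χ)[ιV] = rhoAtLine … ιV a χ` (at the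
`χ_V := toHeckeCharacter L μ`-splittings) is a finite component of `P`, then so is `ω_H(μ, a′, χ)[ιV]`.

THE MATHEMATICS ([Liu2021, Def. 4.11, App. D §D.1 Step 1 footnote l. 5215]: «the isomorphism class of `ω(μ, ε, χ)` depends only on
`(μ, ε, χ)`»; [GelbartRogawski1991, §3.1 Prop. 3.1.1 p. 455 and Remark p. 457]: the oscillator representation of `U(V) × U(W)` depends on
`W` only through its class).  `P.HasFinComponent σ` is the existence of an INJECTIVE `U(H)(𝔸_{L⁺,f})`-intertwiner `σ ↪ P.finRep`
(★ `DiscreteAutomorphicRep.HasFinComponent`).  The tree's line-class transport MASTER ★ `Def411WeilCarriers.lineClassTransport_equiv`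
(every rank, every enumeration) gives, whenever `locF a′ = locF a`, a `U(diag dV)(𝔸_{L⁺,f})`-equivariant linear equivalence
`omegaAtLine … a′ χ ≃ₗ[ℂ] omegaAtLine … a χ`; fed to ★ `H413LineClassTransportOfEquiv.rhoAtLine_lineClassTransport_of_equiv` it is the
socket (C′) ★ `Def411WeilCarriers.rhoAtLine_lineClassTransport`: an injective intertwiner `rhoAtLine … ιV a′ χ ↪ rhoAtLine … ιV a χ` for EVERY
`ιV`.  Composing the two injective intertwiners (Mathlib `Representation.IntertwiningMap.comp`, `Function.Injective.comp`) is the claim.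
No irreducibility, no frame pin, no rank restriction is used.

* §1 `rhoAtLine_lineClassTransport_holds'` — (C′) DISCHARGED: ★ `rhoAtLine_lineClassTransport_of_equiv` ∘ ★ `lineClassTransport_equiv`
  (the one-line discharge announced in both ★ files' docstrings; primed name, local to this namespace, to stay clear of the owner's
  `rhoAtLine_lineClassTransport_holds`).
* §1 `hasFinComponent_of_injective` — `HasFinComponent` pulls back along an injective intertwiner `σ′ ↪ σ` (generic unitary datum).
* §2 **`trHasFinComponentOfLocFEq`** — `sig_K2E2TrHasFinComponentOfLocFEq` TOKEN FOR TOKEN.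

HONEST LABEL: HC_CM is proved only modulo the 7 printed citations (2 remaining named inputs: hLiu418 = stmt-HodgeConjecture-24832,
h413 = stmt-HodgeConjecture-24833) until rung 0 closes; this file is a `--supports stmt-HodgeConjecture-24833 --as helper` leaf (input
of the closer #8 `sig_K2E2TrFinComponentTransport` = tier-0 `stub_finComponentTransport`) and retires nothing by itself.
-/

set_option autoImplicit false

noncomputable section

namespace Summit.HodgeConjecture.HodgeConjecture.Cruxes.H413.K2E2TrHasFinComponentOfLocFEq

open scoped Matrix
open NumberField IsDedekindDomain MeasureTheory
open Literature.NumberTheory.Automorphic Literature.NumberTheory.Automorphic.UnitaryGroup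
open Literature.NumberTheory.Automorphic.Liu2021.Def411WeilCarriers
open Literature.NumberTheory.Automorphic.Liu2021.Def411WeilCarriersDoubling
open Literature.NumberTheory.Automorphic.IdeleClassGroup
open Literature.NumberTheory.GelbartRogawski1991 Literature.NumberTheory.GelbartRogawski1991.UnitaryDualPair
open Literature.RepresentationTheory.Liu2021
open Summit.HodgeConjecture.HodgeConjecture.Cruxes.H413.LineClassTransport (rhoAtLine_lineClassTransport_of_equiv)

/-! ## §1  The two injective intertwiners -/

/-- **(C′) DISCHARGED** — the socket ★ `Def411WeilCarriers.rhoAtLine_lineClassTransport` HOLDS: ★ `rhoAtLine_lineClassTransport_of_equiv`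
(P2, F0P2-p02) applied to the master equivalence ★ `Def411WeilCarriers.lineClassTransport_equiv` (P4, every rank ∕ every frame), whose
statement is `hLT` binder for binder.  For every CM `L`, rank, frame, real non-zero diagonal `dV`, unitary splitting character `χ_V`,
group `G` with `ιV : G →* U(diag dV)(𝔸_{L⁺,f})`, `χ`, and lines `a, a′` with `locF a = locF a′`: an injective `G`-intertwiner
`rhoAtLine … ιV a χ ↪ rhoAtLine … ιV a′ χ`.
[cite: Liu2021, Def. 4.11 (l. 2092–2096); App. D §D.1 Step 1 footnote (l. 5215)] [cite: GelbartRogawski1991, §3.1 Prop. 3.1.1 p. 455; Remark p. 457]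
[cite: MoeglinVignerasWaldspurger1987, Chap. 3 §I.1–I.3] -/
theorem rhoAtLine_lineClassTransport_holds' : rhoAtLine_lineClassTransport :=
  rhoAtLine_lineClassTransport_of_equiv lineClassTransport_equiv

/-- **`HasFinComponent` pulls back along an injective intertwiner.**  For a discrete automorphic representation `P` of `U(J)` (generic
unitary datum `(F, E, c, N, J)`), representations `σ′`, `σ` of `U(J)(𝔸_{F,f})` and an INJECTIVE intertwiner `e : σ′ → σ`: if `σ` is a
finite component of `P` (an injective intertwiner `f : σ ↪ P.finRep`, ★ `DiscreteAutomorphicRep.HasFinComponent`), so is `σ′`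
(`f ∘ e`, Mathlib `Representation.IntertwiningMap.comp`). [cite: BorelJacquet1979, §4.6] [cite: Flath1979, §2] -/
theorem hasFinComponent_of_injective
    {F E : Type} [Field F] [NumberField F] [Field E] [NumberField E] [Algebra F E] {c : E ≃ₐ[F] E} {N : ℕ}
    {J : Matrix (Fin N) (Fin N) E} {μ : Measure (adelicGroupData F E c N J).automorphicQuotient}
    [(adelicGroupData F E c N J).IsAutomorphicMeasure μ]
    (P : DiscreteAutomorphicRep (adelicGroupData F E c N J) μ)
    {V W : Type} [AddCommGroup V] [Module ℂ V] [AddCommGroup W] [Module ℂ W]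
    {σ' : Representation ℂ (finAdelic F E c N J) V} {σ : Representation ℂ (finAdelic F E c N J) W}
    (e : σ'.IntertwiningMap σ) (he : Function.Injective e) (hσ : P.HasFinComponent σ) :
    P.HasFinComponent σ' := by
  obtain ⟨f, hf⟩ := hσ
  exact ⟨f.comp e, hf.comp he⟩

/-! ## §2  The head -/

set_option synthInstance.maxHeartbeats 400000 in
set_option maxHeartbeats 8000000 in
-- heartbeats: EXACTLY the socket's own budget (`K2_E2_ThetaExhaustionByRigidity_ClassTransport.lean` :73–74) — the statement spells Liu's
-- carrier at the `χ_V`-splitting family of two lines (as ★ `lineClassTransport_equiv`, which carries `maxHeartbeats 3200000` for the same reason).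
/-- **PAYMENT OF `sig_K2E2TrHasFinComponentOfLocFEq`** (socket TR-3 = #7 of unit «CLASS-TRANSPORT» of the K2_E2 road,
`Cruxes/H413/Lines/K2_E2_ThetaExhaustionByRigidity_ClassTransport.lean`, TOKEN FOR TOKEN).  **Liu's carrier as a finite component depends
on the line only through its finite classes.**  For ANY `ιV : U(H)(𝔸_{L⁺,f}) →* U(diag dV)(𝔸_{L⁺,f})`, any rank `N`, if `locF a′ = locF a` and
`ω_H(μ, a, χ)[ιV] = rhoAtLine …[e₁] ιV a χ` (at the `toHeckeCharacter L μ`-splittings; `μ` conjugate symplectic ⇒ a splitting character,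
★ `isOscillatorChar_toHeckeCharacter_iff`) is a finite component of `P`, so is `ω_H(μ, a′, χ)[ιV]`: compose the injective intertwiner
`ω(a) ↪ P.finRep` with the injective intertwiner `ω(a′) ↪ ω(a)` of (C′) (§1 `rhoAtLine_lineClassTransport_holds'` at `χ_V := toHeckeCharacter L μ`
and the pair `(a′, a)`) — §1 `hasFinComponent_of_injective`.
[cite: Liu2021, Def. 4.11 (l. 2092–2096); Def. 4.12; App. D §D.1 Step 1 footnote (l. 5215)] [cite: GelbartRogawski1991, §3.1 Prop. 3.1.1 p. 455; Remark p. 457]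
[cite: MoeglinVignerasWaldspurger1987, Chap. 3 §I.1–I.3] [cite: BorelJacquet1979, §4.6] -/
theorem trHasFinComponentOfLocFEq :
    ∀ (L : Type) [Field L] [NumberField L] [IsCMField L] (N : ℕ) (H : Matrix (Fin N) (Fin N) L)
      {n' : ℕ} (e₁ : Fin N × Fin 1 ≃ Fin n') (dV : Fin N → L) (hdV : ∀ i, IsCMField.complexConj L (dV i) = dV i)
      (hdV0 : ∀ i, dV i ≠ 0)
      (ιV : finAdelic (↥(maximalRealSubfield L)) L (IsCMField.complexConj L) N H →*
          finAdelic (↥(maximalRealSubfield L)) L (IsCMField.complexConj L) N (Matrix.diagonal dV))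
      (μA : Measure (adelicGroupData (↥(maximalRealSubfield L)) L (IsCMField.complexConj L) N H).automorphicQuotient)
      [(adelicGroupData (↥(maximalRealSubfield L)) L (IsCMField.complexConj L) N H).IsAutomorphicMeasure μA]
      (P : DiscreteAutomorphicRep (adelicGroupData (↥(maximalRealSubfield L)) L (IsCMField.complexConj L) N H) μA)
      (μ : Literature.NumberTheory.Automorphic.IdeleClassGroup L →ₜ* Circle) (hμ : IsConjugateSymplectic L μ)
      (a a' : (↥(maximalRealSubfield L))ˣ) (χ : Chi (↥(maximalRealSubfield L)) L (IsCMField.complexConj L)),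
      locF (↥(maximalRealSubfield L)) (imagUnitSq L) a' = locF (↥(maximalRealSubfield L)) (imagUnitSq L) a →
      P.HasFinComponent
        (rhoAtLine (↥(maximalRealSubfield L)) L (IsCMField.complexConj L) N e₁ (Matrix.diagonal dV)
          (complexConj_imagUnit L) (imagUnit_ne_zero L) (imagUnit_mul_self L) (realDiagonal_isSymm L dV hdV)
          (isUnit_det_realDiagonal L dV hdV hdV0) (realDiagonal_map L dV hdV).symm
          (fun b => isCompatible_chiSplittingLine L e₁ dV hdV hdV0 (toHeckeCharacter L μ)
            (isUnitary_toHeckeCharacter L μ) ((isOscillatorChar_toHeckeCharacter_iff μ).mpr hμ)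
            (TW (↥(maximalRealSubfield L)) b) (isSymm_TW (↥(maximalRealSubfield L)) b)
            (isUnit_det_TW (↥(maximalRealSubfield L)) b) (JW (↥(maximalRealSubfield L)) L b)
            (JW_eq (↥(maximalRealSubfield L)) L b)) ιV a χ) →
      P.HasFinComponent
        (rhoAtLine (↥(maximalRealSubfield L)) L (IsCMField.complexConj L) N e₁ (Matrix.diagonal dV)
          (complexConj_imagUnit L) (imagUnit_ne_zero L) (imagUnit_mul_self L) (realDiagonal_isSymm L dV hdV)
          (isUnit_det_realDiagonal L dV hdV hdV0) (realDiagonal_map L dV hdV).symm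
          (fun b => isCompatible_chiSplittingLine L e₁ dV hdV hdV0 (toHeckeCharacter L μ)
            (isUnitary_toHeckeCharacter L μ) ((isOscillatorChar_toHeckeCharacter_iff μ).mpr hμ)
            (TW (↥(maximalRealSubfield L)) b) (isSymm_TW (↥(maximalRealSubfield L)) b)
            (isUnit_det_TW (↥(maximalRealSubfield L)) b) (JW (↥(maximalRealSubfield L)) L b)
            (JW_eq (↥(maximalRealSubfield L)) L b)) ιV a' χ) := by
  intro L _ _ _ N H n' e₁ dV hdV hdV0 ιV μA _ P μ hμ a a' χ hloc hfin
  obtain ⟨e, he⟩ := rhoAtLine_lineClassTransport_holds' L e₁ dV hdV hdV0 (toHeckeCharacter L μ)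
    (isUnitary_toHeckeCharacter L μ) ((isOscillatorChar_toHeckeCharacter_iff μ).mpr hμ) ιV χ a' a hloc
  exact hasFinComponent_of_injective P e he hfin

end Summit.HodgeConjecture.HodgeConjecture.Cruxes.H413.K2E2TrHasFinComponentOfLocFEq

end
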